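import Literature.NumberTheory.EllipticCurves.Disegni2020.PAdicBSDRankLeOne
import Literature.NumberTheory.EllipticCurves.Disegni2020.PAdicBSDSplitMultiplicativeRankOne
import Literature.NumberTheory.EllipticCurves.Disegni2020.PAdicBSDRankOneMultiplicativeProofs
import Literature.NumberTheory.EllipticCurves.Disegni2020.PAdicBSDRankOneNonsplitDerived
import Literature.NumberTheory.EllipticCurves.LeadingTermPPartProofs
import Literature.NumberTheory.EllipticCurves.RegulatorProofs
import Literature.NumberTheory.EllipticCurves.MordellWeilRankZeroProofs
import HarnessLib

/-!
# DEDUP CLUSTER D1 (Disegni 2020, Thms. 1/4): the two `x11b3-p2` transcriptions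
# `thm1_padicBSD_nonsplitMultiplicative` (registry A192) and
# `thm4_padicBSD_splitMultiplicative_rankOne` (registry A204) are DERIVED from the registry's facts
# of record A185 `padicBSD_nonsplitMult_rankOne` / A186 `padicBSD_splitMult_rankOne` together with
# Gross–Zagier I.(7.3) and Gross–Zagier–Kolyvagin — theorems only, no definition, no named fact

Topic `Literature/NumberTheory/EllipticCurves` (cluster `Disegni2020`). HONEST FRAMING (BSD rank-`≤ 1`
residual cell `b2b-bsdres`, run/shared/lean/b2b/bsd-rank1-residual/; literature seat = cell lead,
gen 47; referee rulings R132.3 / R133.3 / R134.1 "x11b3-p2's derivations for A192 (p249518) and A204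
(p250734) remain OWED"; CITED-FACTS.md DEDUP CLUSTER D1): the cell deletes COMBINATION-shaped residual
classes from PUBLISHED theorems only and keeps ONE independent transcription per printed display.
Disegni, Kyoto J. Math. 60 (2020), Thm. 1 / Thm. 4 was transcribed seven times by five seats; the
registry's independent rows are A185 (first bullet, non-split, exact identity with the multiplier
`1 - (-1)⁻¹ = 2`) and A186 (second bullet ∘ Venerucci 2016 Thm. D, split, `p ≥ 5`, `E[p]`
irreducible); cc-typer-6 derived A184 ⇐ A185 and A202 ⇐ A186 (`PAdicBSDRankOneNonsplitDerived`,
`PAdicBSDRankOneSplitDerived`), cc-typer-3 derived both clauses of A183 on the irreducible locus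
(`PAdicBSDRankOneMultiplicativeProofs`). This file closes the cluster:

* `thm4_padicBSD_splitMultiplicative_rankOne_of_primary :
    padicBSD_splitMult_rankOne → GrossZagier1986_thm_I_7_3 →
      rank_eq_analyticRank_of_analyticRank_le_one → thm4_padicBSD_splitMultiplicative_rankOne`
  (A204 ⇐ A186: the rank clause is GZK, `#Ш_an ∈ ℚ^×` is Gross–Zagier I.(7.3) 2) with
  `#Ш_an ≠ 0` (`shaAn_ne_zero_of_isNewformOf`), `ord_T L ≥ 2` is A186's vanishing clause, the
  identity is A186's exact clause (3) with the unit `u = 1`);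
* `thm1_padicBSD_nonsplitMultiplicative_of_primary :
    padicBSD_nonsplitMult_rankOne → GrossZagier1986_thm_I_7_3 →
      rank_eq_analyticRank_of_analyticRank_le_one → thm1_padicBSD_nonsplitMultiplicative`
  (A192 ⇐ A185: in analytic rank ONE as for A183's non-split clause
  (`padicBSD_nonsplitMult_rankOne.identity_two`, `ord_T L ≥ 1` from
  `constantCoeff_eq_zero_of_isMultPAdicLFunctionOf_neg_one_of_analyticRank_ne_zero`); in analytic
  rank ZERO the printed display is the INTERPOLATION PROPERTY of the Mazur–Tate–Teitelbaum function
  at a non-split prime, `L(0) = (1 - α⁻¹)·[0]⁺_f = 2·[0]⁺_f` (`IsMultPAdicLFunctionOf.constantCoeff_of_neg_one`,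
  Mazur–Tate–Teitelbaum 1986 §I.14; Greenberg LNM 1716 §4 "`l_v = 2 = (1 - α_v⁻¹)`"), together with
  `[0]⁺_f · Ω⁺_f = L(E,1)` (`IsNewformOf.entireLFunction_one_eq`, MTT §I.8 (8.6)), `ϖ·Ω_E = Ω⁺_f`,
  `Reg(E/ℚ) = 1` and `Reg_p = 1` in rank `0` (`regulator_eq_one_of_rank_zero`,
  `padicRegulator_eq_one_of_finite`) — so `#Ш_an = [0]⁺_f · ϖ · #E(ℚ)_tors² / ∏ c_v ∈ ℚ` and both
  sides of the display equal `2·[0]⁺_f·ϖ·#E(ℚ)_tors²`; this is Disegni's own remark that (BSD_p) in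
  rank `0` at a non-exceptional prime is the interpolation property (Thm. 4: "If … `r = 0`, then
  (BSD_p) holds", §3.2.1), no new source).

Consequence for the registry (lit seat gen 47 block): A192 and A204 become DERIVED (independent count
`0`); D1's independent rows are exactly {A185, A186}; every consumer of A192
(`X11b/CyclotomicNonsplit*.lean`) and of A204 (`X11b/CyclotomicSplitFive.lean`) is fed by
`(A185 ∨ A186) + GZ + GZK`, the inputs cc-typer-3's derivation already uses. Nothing asserted; no
converse claimed (A192's rank-`0` clause is not implied by A185 alone, and A185/A186 quantify over an
externally given `s = #Ш_an`, which A192/A204 produce).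

References: [Disegni2020] Thm. 1 (§1.2), Thm. 4 (§3.2), Prop. 2 (§3.1), Props. 4–5 (§3.2.2),
formula (BSD_p) §1.1.4; [Venerucci2016] Thm. D; [GrossZagier1986] Thm. I.(7.3) 2);
[MazurTateTeitelbaum1986Invent] §I.8 (8.6), §I.14; [GreenbergLNM1716] §4 (PDF p. 113);
[SteinWuthrich2013] §4.2; CITED-FACTS.md §A A183–A186, A192, A202, A204.
-/

set_option autoImplicit false

noncomputable section

open scoped Classical MatrixGroups ModularForm

open CongruenceSubgroup WeierstrassCurve Literature.NumberTheory.EllipticCurves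
  Literature.NumberTheory.EllipticCurves.ModularForms
  Literature.NumberTheory.EllipticCurves.SteinWuthrich2013

namespace Literature.NumberTheory.EllipticCurves.Disegni2020

/-- **A204 ⇐ A186 + GZ + GZK (DEDUP CLUSTER D1, split clause, `x11b3-p2`'s shape).** The
transcription `thm4_padicBSD_splitMultiplicative_rankOne` of Disegni 2020 Thm. 4 (second bullet, exact
form: `p ≥ 5` split multiplicative, `E[p]` irreducible, a second multiplicative prime, analytic rank
one) follows from the exact transcription `padicBSD_splitMult_rankOne` (A186) — vanishing clause (1)
for `ord_T L ≥ r_an + 1 = 2`, exact clause (3) for the identity with `u = 1` — with the rank clause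
from Gross–Zagier–Kolyvagin (`hGZK`) and `#Ш_an = s ∈ ℚ`, `s ≠ 0`, from Gross–Zagier I.(7.3) 2)
(`hGZ`, `exists_rat_shaAn_eq_of_analyticRank_eq_one`) and `shaAn_ne_zero_of_isNewformOf`. No
converse. [cite: Disegni2020, Thm. 4 second bullet (§3.2), Props. 4–5, Thm. 1 (§1.2)]
[cite: Venerucci2015, Thm. D] [cite: GrossZagier1986, Thm. I.(7.3) 2) (p. 231)] -/
theorem thm4_padicBSD_splitMultiplicative_rankOne_of_primary (h : padicBSD_splitMult_rankOne)
    (hGZ : GrossZagier1986_thm_I_7_3) (hGZK : rank_eq_analyticRank_of_analyticRank_le_one) :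
    thm4_padicBSD_splitMultiplicative_rankOne := by
  intro W _ _ p _ hp5 Dq hirr hm hr Dh hDh N _ f hf L hL ϖ hϖ
  obtain ⟨hrank, -⟩ := hGZK W (by omega)
  obtain ⟨s, hs⟩ := exists_rat_shaAn_eq_of_analyticRank_eq_one hGZ hGZK W hr
  obtain ⟨hvan, -, hexact⟩ := h W p hp5 Dq hirr hr f hf L hL Dh hDh ϖ hϖ s hs
  have hs0 : s ≠ 0 := by
    intro h0
    apply shaAn_ne_zero_of_isNewformOf hf
    rw [hs, h0, Rat.cast_zero]
  have h2 : W.analyticRank + 1 = 2 := by omega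
  refine ⟨hrank, ?_, s, 1, hs, hs0, ?_⟩
  · rw [h2]
    exact_mod_cast padicBSD_splitMult_rankOne.two_le_order hvan
  · rw [h2, Units.val_one, PadicInt.coe_one, one_mul]
    exact hexact hm

/-- **A192 ⇐ A185 + GZ + GZK (DEDUP CLUSTER D1, non-split clause in analytic rank `≤ 1`,
`x11b3-p2`'s shape).** The transcription `thm1_padicBSD_nonsplitMultiplicative` of Disegni 2020
Thm. 1 (= Thm. 4, first bullet) at a non-split multiplicative `p ≠ 2` in analytic rank `≤ 1` follows
from the exact rank-one transcription `padicBSD_nonsplitMult_rankOne` (A185), Gross–Zagier I.(7.3) 2)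
(`hGZ`) and Gross–Zagier–Kolyvagin (`hGZK`): in rank ONE as in
`Disegni2020.nonsplitClause_of_primary` (`u = 1`, `ord_T L ≥ 1` from the vanishing of
`L(0) = 2·[0]⁺_f = 2·L(E,1)/Ω⁺_f`); in rank ZERO the display
`ϖ·[T⁰]L·#T² = u·2·#Ш_an·Reg_p·∏ c_v` IS the interpolation property `L(0) = (1 - α⁻¹)[0]⁺_f = 2·[0]⁺_f`
of THE Mazur–Tate–Teitelbaum function at a non-split prime (`IsMultPAdicLFunctionOf.constantCoeff_of_neg_one`)
combined with `[0]⁺_f·Ω⁺_f = L(E,1)` (`IsNewformOf.entireLFunction_one_eq`), `ϖ·Ω_E = Ω⁺_f`,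
`Reg(E/ℚ) = Reg_p = 1` in rank `0` and the definition of `#Ш_an` (`shaAn_def`), which give
`#Ш_an = [0]⁺_f·ϖ·#T²/∏ c_v ∈ ℚ^×` and the identity with `u = 1` (Disegni 2020 Thm. 4: "if … `r = 0`,
then (BSD_p) holds", §3.2.1). No converse. [cite: Disegni2020, Thm. 1 (§1.2), Thm. 4 first bullet and §3.2.1, Prop. 2 (§3.1)]
[cite: MazurTateTeitelbaum1986Invent, §I.8 (8.6) and §I.14] [cite: GreenbergLNM1716, §4 (PDF p. 113)]
[cite: GrossZagier1986, Thm. I.(7.3) 2) (p. 231)] -/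
theorem thm1_padicBSD_nonsplitMultiplicative_of_primary (h : padicBSD_nonsplitMult_rankOne)
    (hGZ : GrossZagier1986_thm_I_7_3) (hGZK : rank_eq_analyticRank_of_analyticRank_le_one) :
    thm1_padicBSD_nonsplitMultiplicative := by
  intro W _ _ p _ hp hmult hns hr q hq0 hq1 hqj Dh hDh N _ f hf L hL ϖ hϖ
  obtain ⟨hrank, -⟩ := hGZK W hr
  obtain h0 | h1 : W.analyticRank = 0 ∨ W.analyticRank = 1 := by omega
  · -- analytic rank `0`: the interpolation property of `L` at `T = 0`
    have hmw : W.mordellWeilRank = 0 := hrank.trans h0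
    haveI : Finite W.toAffine.Point := (W.mordellWeilRank_eq_zero_iff_finite).mp hmw
    have hRegp : padicRegulator Dh = 1 := padicRegulator_eq_one_of_finite W p Dh
    have hReg : W.regulator = 1 := W.regulator_eq_one_of_rank_zero hmw
    have hLead : W.leadingLCoeff = W.entireLFunction 1 :=
      W.leadingLCoeff_eq_of_analyticRank_eq_zero h0
    have hL0 : PowerSeries.constantCoeff L = 2 * ((ratPlusSymbol f 0 : ℚ) : ℚ_[p]) :=
      hL.constantCoeff_of_neg_one
    have hΩ : (W.realPeriodRat : ℂ) ≠ 0 := by exact_mod_cast W.realPeriodRat_pos_holds.ne'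
    have hcC : (W.tamagawaProduct : ℂ) ≠ 0 := by exact_mod_cast (W.tamagawaProduct_pos').ne'
    have hcP : (W.tamagawaProduct : ℚ_[p]) ≠ 0 := by exact_mod_cast (W.tamagawaProduct_pos').ne'
    -- `#Ш_an = [0]⁺_f · ϖ · #T² / ∏ c_v`
    set s : ℚ := ratPlusSymbol f 0 * ϖ * (W.torsionOrder : ℚ) ^ 2 / W.tamagawaProduct with hs_def
    have hs : shaAn W = (s : ℂ) := by
      rw [shaAn_def, hLead, hf.entireLFunction_one_eq, hReg, ← hϖ, hs_def]
      push_cast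
      field_simp
    have hs0 : s ≠ 0 := by
      intro hz
      apply shaAn_ne_zero_of_isNewformOf hf
      rw [hs, hz, Rat.cast_zero]
    refine ⟨hrank, ?_, s, 1, hs, hs0, ?_⟩
    · rw [h0, Nat.cast_zero]
      exact _root_.zero_le
    · rw [h0, pow_zero, mul_one, PowerSeries.coeff_zero_eq_constantCoeff_apply, hL0, hRegp, mul_one,
        Units.val_one, PadicInt.coe_one, one_mul, hs_def]
      push_cast
      field_simp
  · -- analytic rank `1`: A185's exact identity with the multiplier `2`, `u = 1`
    obtain ⟨s, hs⟩ := exists_rat_shaAn_eq_of_analyticRank_eq_one hGZ hGZK W h1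
    have hs0 : s ≠ 0 := by
      intro hz
      apply shaAn_ne_zero_of_isNewformOf hf
      rw [hs, hz, Rat.cast_zero]
    have hc0 : PowerSeries.constantCoeff L = 0 :=
      constantCoeff_eq_zero_of_isMultPAdicLFunctionOf_neg_one_of_analyticRank_ne_zero hf (by omega) hL
    refine ⟨hrank, ?_, s, 1, hs, hs0, ?_⟩
    · rw [h1]
      refine PowerSeries.nat_le_order _ 1 fun i hi ↦ ?_
      interval_cases i
      simpa using hc0
    · rw [h1, pow_one, Units.val_one, PadicInt.coe_one, one_mul]
      exact padicBSD_nonsplitMult_rankOne.identity_two h W p hp hmult hns h1 hq0 hq1 hqj hf hL hDh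
        hϖ hs

end Literature.NumberTheory.EllipticCurves.Disegni2020

end
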